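import Literature.AlgebraicGeometry.HodgeTheory.WeilClassesFieldDecomposableOfSymmetric
import Literature.AlgebraicGeometry.HodgeTheory.WeilClassesFieldIntersections
import Literature.AlgebraicGeometry.HodgeTheory.AbelianLowDimensionWeilReductionProofs
import Literature.AlgebraicGeometry.HodgeTheory.LefschetzOneOneHolds
import HarnessLib

/-!
# Weil classes relative to `F` are ALGEBRAIC as soon as `G_div(X) ⊆ Sl_F(V_X)` — and are algebraic for `F = ℚ(φ)`
# pointwise Rosati-fixed (Moonen–Zarhin 1998, Introduction × Criterion (2), carried to the Hodge conjecture)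

Layer `Literature/AlgebraicGeometry/HodgeTheory`; THEOREMS ONLY — no definition, no named fact, sorry-free (D-0026,
net debt 0). Junction of the seat's `HodgeTheory/WeilClassesFieldDecomposableIffDivisorLefschetzGroup` (g14-#3: «`W_F`
decomposable ⟺ `G_div(X) ⊆ Sl_F(V_X)`» on the carrier) and `HodgeTheory/WeilClassesFieldDecomposableOfSymmetric`
(g17-#3: for `F = ℚ(φ)` with `φ^*` `Q_h`-symmetric, `W_F ⊗ ℂ ≤ 𝒟ᵐ ⊗ ℂ` outright) with the tree's Lefschetz theorem on
`(1,1)`-classes (`lefschetzOneOne_rational_holds`, Voisin I Thm. 11.30) through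
`AbelianVariety.divisorClassesSpan_le_algebraicClasses` («if `𝒟ᵖ = ℬᵖ` then the Hodge `(p,p)`-conjecture is true»)
and with `divisorClassesSpan_le_hodgeClassSpan_of_isSmoothProjective` (`𝒟ᵖ ⊆ ℬᵖ`).

## The print

B. J. J. Moonen, Yu. G. Zarhin, *Weil classes on abelian varieties*, J. reine angew. Math. **496** (1998) =
arXiv:alg-geom/9612017 [MoonenZarhin1998WeilClasses] (held text `paper:arxiv-alg-geom_9612017`), Introduction
(chunk p0001 L10–L18, verbatim): «We call a class `c ∈ ℬ•(X)` decomposable if it lies in the subalgebra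
`𝒟•(X) ⊆ ℬ•(X)` generated by divisor classes. The non-decomposable Hodge classes are called exceptional classes. As a
consequence of the Lefschetz theorem on `(1,1)` classes, the decomposable classes are algebraic; in particular, if
`ℬ•(X) = 𝒟•(X)` then the Hodge conjecture for `X` is true.»; Criterion (2) (chunk p0003 L46–L58).

## What is proved (carriers as in g14-#3 / g17-#3: `P(φ) = 0`, `P ∈ ℤ[T]` monic irreducible of degree `e`,
`e · 2m = 2 dim A`, `h ∈ B¹(A) ⊗ ℂ` with `Q_h` non-degenerate)

* §1 **`weilClassesField_le_algebraicClasses_of_divisorLefschetzGroup_le_slF`** — configuration-free: if every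
  `u ∈ G_div(X)(ℂ)` commutes with `φ^*` and has `det(u | V_ρ) = 1` at every complex root `ρ` of `P` («`G_div(X) ⊆
  Sl_F(V_X)`»), then `W_F ⊗ ℂ ≤ N^m H^{2m}(A(ℂ); ℂ)` (`algebraicClasses A.X m`): «hence `G_div(X)` acts trivially on `W_F`»
  (decomposable, g14-#3) and «the decomposable classes are algebraic» (Lefschetz `(1,1)`, a theorem of the tree, and
  products); with `…_le_hodgeClassSpan_of_divisorLefschetzGroup_le_slF` (`≤ ℬᵐ ⊗ ℂ`).
* §2 (`Q_h(φ^* x, y) = Q_h(x, φ^* y)`, `0 < dim A`) **`weilClassesField_le_hodgeClassSpan_of_symm`** — `W_F ⊗ ℂ ≤ ℬᵐ ⊗ ℂ`: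
  the Weil classes relative to `F = ℚ(φ)` are (combinations of rational) HODGE classes (through `𝒟ᵐ ⊆ ℬᵐ`; the
  print's Criterion (1) route `n_σ = n_{σ'}` is not used); **`weilClassesField_le_algebraicClasses_of_symm`** —
  `W_F ⊗ ℂ ≤ algebraicClasses A.X m`: THE WEIL CLASSES RELATIVE TO A FIELD OF ROSATI-SYMMETRIC ENDOMORPHISMS ARE
  ALGEBRAIC (outright, g17-#3); element form `mem_algebraicClasses_of_mem_weilClassesField_of_symm`.

Scope: §1 is the print's mechanism with its algebraic-group step left as the HYPOTHESIS; §2 has exactly the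
hypotheses of g17-#3 (see its scope sentence for the print's cases: type 1 with `m = 1`, «Type 3, `m = 1`, `F ⊆ E`»,
«Type 4, `d = 1`, `m = 1`, `F ⊆ E₀`», `F ⊆ E₀` in type 4); nothing is claimed outright for `F` not pointwise
Rosati-fixed, and nothing about exceptional classes.

## References

* [MoonenZarhin1998WeilClasses] B. J. J. Moonen, Yu. G. Zarhin, J. reine angew. Math. 496 (1998) =
  arXiv:alg-geom/9612017, Introduction (chunk p0001 L10–L18), §1 Criterion (2) and its proof (chunk p0003 L46–L70).
* [Milne1999LefschetzClasses] J. S. Milne, Lefschetz classes on abelian varieties, Duke Math. J. 96 (1999), Thm. 3.2,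
  Cor. 4.5.
* [VoisinHodgeI2002] C. Voisin, Hodge Theory and Complex Algebraic Geometry I (CUP 2002), Thm. 11.30 (Lefschetz
  theorem on `(1,1)`-classes).
* [vanGeemen1994HodgeAV] B. van Geemen, An introduction to the Hodge conjecture for abelian varieties, LNM 1594
  (1994), §2.4–2.5 (`𝒟ᵖ ⊆ ℬᵖ`, exceptional classes).

## Provenance

Lane `lit-hodgefound` (Track 2, Layer A), prover seat `lit-hodgefound-p21` (generation 17), row g17-#4 (junction of
g14-#3 / g17-#3 with Lefschetz `(1,1)`).
-/

noncomputable section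

open CategoryTheory Polynomial Module

namespace Literature.AlgebraicGeometry.HodgeTheory

open Literature.AlgebraicGeometry.Motives
open Literature.AlgebraicGeometry.VanGeemen1994 (hodgeClassSpan pullbackOne detOnEigenspace)
open Literature.AlgebraicTopology.SingularHomology
open Literature.Barriers.HodgeConjecture (divisorClassesSpan)

section HodgeTheory

variable {A : AbelianVariety ℂ} {h : complexBetti A.X 2} {φ : A ⟶ A} {P : Polynomial ℤ} {e m : ℕ}

/-! ### §1 Configuration-free: `G_div(X) ⊆ Sl_F(V_X)` ⟹ `W_F` consists of algebraic classes -/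

/-- **`G_div(X) ⊆ Sl_F(V_X)` ⟹ the Weil classes relative to `F = ℚ(φ)` are Hodge classes**: if every `u ∈ G_div(X)(ℂ)`
commutes with `φ^*` and has `det(u | V_ρ) = 1` at every complex root `ρ` of `P` (`P ∈ ℤ[T]` monic irreducible of
degree `e`, `P(φ) = 0`, `e · 2m = 2 dim A`; `h ∈ B¹(A) ⊗ ℂ` with `Q_h` non-degenerate), then `W_F ⊗ ℂ ≤ 𝒟ᵐ ⊗ ℂ ≤ ℬᵐ ⊗ ℂ`
(g14-#3's `weilClassesField_le_divisorClassesSpan_iff_divisorLefschetzGroup_le_slF`, then `𝒟ᵐ ⊆ ℬᵐ`).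
[cite: MoonenZarhin1998WeilClasses, §1 proof of Criterion (2) (chunk p0003 L62–L70)] [cite: vanGeemen1994HodgeAV, §2.4] -/
theorem weilClassesField_le_hodgeClassSpan_of_divisorLefschetzGroup_le_slF
    (hPm : P.Monic) (hPe : P.natDegree = e) (hPirr : Irreducible (P.map (Int.castRingHom ℚ)))
    (hφ : Polynomial.eval₂ (Int.castRingHom (CategoryTheory.End A)) (φ : CategoryTheory.End A) P = 0)
    (her : e * (2 * m) = 2 * A.dim) (hh : h ∈ hodgeClassSpan A.dim A.X 1)
    (hnd : ∀ x : complexBetti A.X 1, (∀ y, polarizationPairingOne A.X h (A.dim - 1) x y = 0) → x = 0)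
    (hsl : ∀ u ∈ divisorLefschetzGroup A h, ∃ hc : ∀ x, u (pullbackOne A φ x) = pullbackOne A φ (u x),
      ∀ ρ : ℂ, Polynomial.eval₂ (Int.castRingHom ℂ) ρ P = 0 → detOnEigenspace u (pullbackOne A φ) hc ρ = 1) :
    weilClassesField A φ P (2 * m) ≤ hodgeClassSpan A.dim A.X m :=
  ((weilClassesField_le_divisorClassesSpan_iff_divisorLefschetzGroup_le_slF hPm hPe hPirr hφ her hh hnd).2 hsl).trans
    (divisorClassesSpan_le_hodgeClassSpan_of_isSmoothProjective (AbelianVariety.isSmoothProjective_holds (A := A)) m)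

/-- **`G_div(X) ⊆ Sl_F(V_X)` ⟹ the Weil classes relative to `F = ℚ(φ)` are ALGEBRAIC** — «hence `G_div(X)` acts
trivially on `W_F`» (all classes of `W_F` decomposable: g14-#3's
`weilClassesField_le_divisorClassesSpan_iff_divisorLefschetzGroup_le_slF`) and «as a consequence of the Lefschetz
theorem on `(1,1)` classes, the decomposable classes are algebraic» (the tree's theorem `lefschetzOneOne_rational_holds`
and `AbelianVariety.divisorClassesSpan_le_algebraicClasses`): under the hypotheses of the previous theorem,
`W_F ⊗ ℂ ≤ N^m H^{2m}(A(ℂ); ℂ)` (`algebraicClasses A.X m`). The print's remaining step — «`G_div(X)` is connected and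
semi-simple, so `G_div(X) ⊆ Sl_F(V_X)`» in the decomposable cases — is the HYPOTHESIS `hsl` here (discharged outright
in §2 for `φ^*` `Q_h`-symmetric). [cite: MoonenZarhin1998WeilClasses, Introduction (chunk p0001 L10–L18) and §1 proof of Criterion (2) (chunk p0003 L62–L70)]
[cite: VoisinHodgeI2002, Thm. 11.30] -/
theorem weilClassesField_le_algebraicClasses_of_divisorLefschetzGroup_le_slF
    (hPm : P.Monic) (hPe : P.natDegree = e) (hPirr : Irreducible (P.map (Int.castRingHom ℚ)))
    (hφ : Polynomial.eval₂ (Int.castRingHom (CategoryTheory.End A)) (φ : CategoryTheory.End A) P = 0)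
    (her : e * (2 * m) = 2 * A.dim) (hh : h ∈ hodgeClassSpan A.dim A.X 1)
    (hnd : ∀ x : complexBetti A.X 1, (∀ y, polarizationPairingOne A.X h (A.dim - 1) x y = 0) → x = 0)
    (hsl : ∀ u ∈ divisorLefschetzGroup A h, ∃ hc : ∀ x, u (pullbackOne A φ x) = pullbackOne A φ (u x),
      ∀ ρ : ℂ, Polynomial.eval₂ (Int.castRingHom ℂ) ρ P = 0 → detOnEigenspace u (pullbackOne A φ) hc ρ = 1) :
    weilClassesField A φ P (2 * m) ≤ algebraicClasses A.X m :=
  ((weilClassesField_le_divisorClassesSpan_iff_divisorLefschetzGroup_le_slF hPm hPe hPirr hφ her hh hnd).2 hsl).trans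
    (AbelianVariety.divisorClassesSpan_le_algebraicClasses A
      (fun b hb hb' ↦ lefschetzOneOne_rational_holds (AbelianVariety.isSmoothProjective_holds (A := A)) b hb hb') m)

/-! ### §2 `F = ℚ(φ)` pointwise Rosati-fixed: the Weil classes ARE algebraic -/

/-- **Weil classes relative to `F = ℚ(φ)` with `φ^*` `Q_h`-symmetric are Hodge classes**: `W_F ⊗ ℂ ≤ ℬᵐ ⊗ ℂ`
(`W_F ⊗ ℂ ≤ 𝒟ᵐ ⊗ ℂ ≤ ℬᵐ ⊗ ℂ`). [cite: MoonenZarhin1998WeilClasses, Introduction (chunk p0001 L10–L18) and §1 Criterion (2)]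
[cite: vanGeemen1994HodgeAV, §2.4] -/
theorem weilClassesField_le_hodgeClassSpan_of_symm (hA : 0 < A.dim)
    (hPm : P.Monic) (hPe : P.natDegree = e) (hPirr : Irreducible (P.map (Int.castRingHom ℚ)))
    (hφ : Polynomial.eval₂ (Int.castRingHom (CategoryTheory.End A)) (φ : CategoryTheory.End A) P = 0)
    (her : e * (2 * m) = 2 * A.dim) (hh : h ∈ hodgeClassSpan A.dim A.X 1)
    (hnd : ∀ x : complexBetti A.X 1, (∀ y, polarizationPairingOne A.X h (A.dim - 1) x y = 0) → x = 0)
    (hsym : ∀ x y : complexBetti A.X 1, polarizationPairingOne A.X h (A.dim - 1) (pullbackOne A φ x) y =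
      polarizationPairingOne A.X h (A.dim - 1) x (pullbackOne A φ y)) :
    weilClassesField A φ P (2 * m) ≤ hodgeClassSpan A.dim A.X m :=
  (weilClassesField_le_divisorClassesSpan_of_symm hA hPm hPe hPirr hφ her hh hnd hsym).trans
    (divisorClassesSpan_le_hodgeClassSpan_of_isSmoothProjective (AbelianVariety.isSmoothProjective_holds (A := A)) m)

/-- **Weil classes relative to a field of Rosati-symmetric endomorphisms are ALGEBRAIC**: `W_F ⊗ ℂ ≤ N^m H^{2m}`
(`algebraicClasses A.X m`) — «as a consequence of the Lefschetz theorem on `(1,1)` classes, the decomposable classes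
are algebraic»: `W_F ⊗ ℂ ≤ 𝒟ᵐ ⊗ ℂ` (g17-#3), Lefschetz `(1,1)` (the tree's theorem `lefschetzOneOne_rational_holds`), and
cup products of algebraic classes on an abelian variety are algebraic (`AbelianVariety.divisorClassesSpan_le_algebraicClasses`).
[cite: MoonenZarhin1998WeilClasses, Introduction (chunk p0001 L10–L18) and §1 Criterion (2) (chunk p0003 L46–L58)]
[cite: VoisinHodgeI2002, Thm. 11.30] -/
theorem weilClassesField_le_algebraicClasses_of_symm (hA : 0 < A.dim)
    (hPm : P.Monic) (hPe : P.natDegree = e) (hPirr : Irreducible (P.map (Int.castRingHom ℚ)))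
    (hφ : Polynomial.eval₂ (Int.castRingHom (CategoryTheory.End A)) (φ : CategoryTheory.End A) P = 0)
    (her : e * (2 * m) = 2 * A.dim) (hh : h ∈ hodgeClassSpan A.dim A.X 1)
    (hnd : ∀ x : complexBetti A.X 1, (∀ y, polarizationPairingOne A.X h (A.dim - 1) x y = 0) → x = 0)
    (hsym : ∀ x y : complexBetti A.X 1, polarizationPairingOne A.X h (A.dim - 1) (pullbackOne A φ x) y =
      polarizationPairingOne A.X h (A.dim - 1) x (pullbackOne A φ y)) :
    weilClassesField A φ P (2 * m) ≤ algebraicClasses A.X m :=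
  (weilClassesField_le_divisorClassesSpan_of_symm hA hPm hPe hPirr hφ her hh hnd hsym).trans
    (AbelianVariety.divisorClassesSpan_le_algebraicClasses A
      (fun b hb hb' ↦ lefschetzOneOne_rational_holds (AbelianVariety.isSmoothProjective_holds (A := A)) b hb hb') m)

/-- Element form: every class of `W_F ⊗ ℂ` (in particular every rational Weil class relative to `F`) lies in the
`ℂ`-span of the algebraic classes. [cite: MoonenZarhin1998WeilClasses, Introduction (chunk p0001 L10–L18)] -/
theorem mem_algebraicClasses_of_mem_weilClassesField_of_symm (hA : 0 < A.dim)
    (hPm : P.Monic) (hPe : P.natDegree = e) (hPirr : Irreducible (P.map (Int.castRingHom ℚ)))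
    (hφ : Polynomial.eval₂ (Int.castRingHom (CategoryTheory.End A)) (φ : CategoryTheory.End A) P = 0)
    (her : e * (2 * m) = 2 * A.dim) (hh : h ∈ hodgeClassSpan A.dim A.X 1)
    (hnd : ∀ x : complexBetti A.X 1, (∀ y, polarizationPairingOne A.X h (A.dim - 1) x y = 0) → x = 0)
    (hsym : ∀ x y : complexBetti A.X 1, polarizationPairingOne A.X h (A.dim - 1) (pullbackOne A φ x) y =
      polarizationPairingOne A.X h (A.dim - 1) x (pullbackOne A φ y))
    {c : complexBetti A.X (2 * m)} (hc : c ∈ weilClassesField A φ P (2 * m)) : c ∈ algebraicClasses A.X m :=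
  weilClassesField_le_algebraicClasses_of_symm hA hPm hPe hPirr hφ her hh hnd hsym hc

end HodgeTheory

end Literature.AlgebraicGeometry.HodgeTheory

end
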